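import Summits.AnomalousDissipation.AnomalousDissipation.Theses.SteadyMirrorGate
import Summits.AnomalousDissipation.AnomalousDissipation.Theorems.MirrorEnsembleMirrorStatisticsLoudTGStubTubeProfilesK
import Summits.AnomalousDissipation.AnomalousDissipation.Theorems.MirrorEnsembleMirrorStatisticsLoudTGStubOddPoincareK
import Summits.AnomalousDissipation.AnomalousDissipation.Theorems.MirrorEnsembleMirrorStatisticsLoudTGStubTubeLawSmoothK
import Summits.AnomalousDissipation.AnomalousDissipation.Theorems.MirrorEnsembleMirrorStatisticsLoudTGStubTubeLawTransferK
import Literature.Analysis.FunctionSpaces.TorusTestFunctionProofs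
import Literature.Analysis.FluidPDE.StatisticalSolutionDirac
import HarnessLib

/-!
# `NoThinMirrorRootTG` holds (route `SteadyMirrorGate`, item stmt-AnomalousDissipation-27200)

**Statement (split child A of the deciding crux `NoMirrorDodgerTG`).** At the pinned Taylor–Green force
`f_TG = (sin 2πx₀ cos 2πx₁ cos 2πx₂, −cos 2πx₀ sin 2πx₁ cos 2πx₂, 0)`, no `v ∈ V` in the mirror class
`Fix K` (`v_j(R_i x) = ∓ v_j(x)` a.e., `R_i x = update x i (−x i)`) that is THIN AT THE SKELETON — it admits
square-integrable weak partial derivatives `g_j` with `liminf_{δ→0} δ⁻¹ ∫_{T_δ} ∑ⱼ ‖g_j‖² = 0`, `T_δ` the `δ`-tube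
of the skeleton edge grid `{x₂ = 0, x₀ or x₁ ∈ {0, ½}}` — is a steady weak Euler state of `f_TG`
(`Torus.IsSteadyWeakSolution 0 f_TG v`).

**Proof (Kelvin circulation balance on the skeleton loop, in the FMRT weak currency).** The landed stubs of
line `regimes` of the sibling crux `MirrorEnsemble.MirrorStatisticsLoudTG` are the whole machine; this file is
the assembly at one deterministic field:

* T1 `stub_tubeProfilesK`: for every width `δ' ≤ δ₁` a smooth solenoidal mean-zero TUBE CURRENT
  `w_{δ'} = (η(x₂)ρ(x₀)ρ'(x₁), −η(x₂)ρ'(x₀)ρ(x₁), 0)` around the loop `∂([0,½]² × {x₂ = 0})` with profile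
  bounds `|η|, |ρ'| ≤ A/δ'`, `|ρ| ≤ 1` and PUMP `(f_TG, w_{δ'}) ≥ 1`;
* T2a/T2b `stub_tubeLawSmoothK stub_oddPoincareK`: the KELVIN TUBE LAW for smooth solenoidal mean-zero
  exactly `K`-symmetric fields `u`: `|∫ ⟪Dw_{δ'}[u], u⟫| ≤ K A³ δ'⁻¹ ∫_{N_{δ'}} ∑ⱼ ‖∂ⱼu‖²`, `N_{δ'}` the
  `2δ'`-neighbourhood of the four edges inside the slab `‖x₂‖ ≤ δ'`;
* T3 `stub_tubeLawTransferK`: the tube law passes to every finite-enstrophy `L²` class `v ∈ Fix K ⊆ H`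
  (Galerkin truncations are exactly `K`-symmetric, Brachet et al. 1983, §2; `∂ⱼ P_N v = P_N wⱼ`; `N → ∞`,
  Robinson–Rodrigo–Sadowski 2016, Lemma 4.1, FMRT 2001, Ch. IV (1.9)): `|∫ (v ⊗ v) : ∇w_{δ'}| ≤ K A³ δ'⁻¹ Λ`
  for every majorant `Λ` of the local enstrophy `∫_{N_{δ'}} ∑ⱼ ‖wⱼ‖²` of its weak gradients `w`.

Assembly (`noThinMirrorRootTG`): `v ∈ V` has finite enstrophy (`Torus.MemSobolev.eGradNormSq_lt_top`) and its
a.e. mirror class is literally `mirrorClass`; weak derivatives are unique a.e. (Evans 2010, §5.2.1, Lemma;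
`Torus.HasWeakPartialDeriv.unique_holds`), so the local enstrophy of ANY square-integrable weak gradient of `v`
on `N_{δ'}` equals that of the GIVEN thin gradient `g`, which is therefore an admissible majorant. Thinness at
`η₀ = 1/(4KA³)` gives `δ < δ₁` with `∫_{T_δ} ∑ⱼ ‖gⱼ‖² ≤ η₀ δ`; take `δ' = δ/3`, so `N_{δ/3} ⊆ T_δ` and
`|∫ (v ⊗ v) : ∇w| ≤ (3KA³/δ) · η₀ δ = 3/4`; the steady weak Euler equation tested with `w = w_{δ/3}` reads
`(f_TG, w) + ∫ (v ⊗ v) : ∇w = 0` with `(f_TG, w) ≥ 1` — contradiction.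

References: M. E. Brachet, D. I. Meiron, S. A. Orszag, B. G. Nickel, R. H. Morf, U. Frisch, *Small-scale
structure of the Taylor–Green vortex*, J. Fluid Mech. 130 (1983) 411–452, §2 [doi:10.1017/s0022112083001159];
C. Foias, O. Manley, R. Rosa, R. Temam, *Navier–Stokes Equations and Turbulence* (CUP 2001), Ch. IV §1
[FMRTTurbulence2001]; J. C. Robinson, J. L. Rodrigo, W. Sadowski, *The Three-Dimensional Navier–Stokes
Equations* (CUP 2016), §4.1, Lemma 4.1 [RobinsonRodrigoSadowski2016]; L. C. Evans, *Partial Differential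
Equations*, 2nd ed. (AMS 2010), §5.2.1 Lemma, §5.8 Thm. 8 [Evans2010].
-/

-- every `Summit.AnomalousDissipation.AnomalousDissipation.…` name repeats the summit = problem segment (tree layout)
set_option linter.dupNamespace false

noncomputable section

namespace Summit.AnomalousDissipation.AnomalousDissipation.Theorems.SteadyMirrorGateNoThinMirrorRootTG

open MeasureTheory Filter Topology UnitAddTorus
open scoped ENNReal InnerProductSpace NNReal
open Literature.Analysis.FunctionSpaces Literature.Analysis.FluidPDE
open Summit.AnomalousDissipation.AnomalousDissipation.Theorems.TaylorGreenLoudGalerkinStates.Negative (tgForce)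
open Summit.AnomalousDissipation.AnomalousDissipation.Theorems.MirrorStatisticsLoudTG.Negative (mirrorClass)
open Summit.AnomalousDissipation.AnomalousDissipation.Theorems.MirrorEnsembleMirrorStatisticsLoudTG
  (stub_tubeProfilesK stub_oddPoincareK stub_tubeLawSmoothK stub_tubeLawTransferK)

/-- **`NoThinMirrorRootTG` holds** (route `SteadyMirrorGate`, split child A of `NoMirrorDodgerTG`): at the pinned
Taylor–Green force no `V`-field of the mirror class that is thin at the skeleton is a steady weak Euler state.
Kelvin circulation balance on the skeleton loop `∂([0,½]² × {0})`: the tube current `w` of width `δ/3` has pump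
`(f_TG, w) ≥ 1` (T1 `stub_tubeProfilesK`) while, by the tube law (T2 `stub_tubeLawSmoothK stub_oddPoincareK`)
transferred to `v` (T3 `stub_tubeLawTransferK`, with the thin gradient as majorant by uniqueness of weak
derivatives) and thinness, `|∫ (v ⊗ v) : ∇w| ≤ 3/4`; the steady weak Euler equation
`(f_TG, w) + ∫ (v ⊗ v) : ∇w = 0` is violated. [folklore] -/
theorem noThinMirrorRootTG : Theses.SteadyMirrorGate.NoThinMirrorRootTG := by
  intro f hf v hV hK hthin hsol
  obtain ⟨g, hg, hthin⟩ := hthin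
  -- T1/T2: the tube machine of line `regimes`
  obtain ⟨A, δ₁, hA, hδ₁, hδ₁le, hprof⟩ := stub_tubeProfilesK
  obtain ⟨K, hK0, htube⟩ := stub_tubeLawSmoothK stub_oddPoincareK
  have hA0 : 0 < A := lt_of_lt_of_le one_pos hA
  have hKA : 0 < K * A ^ 3 := by positivity
  -- a thin tube at `η₀ = 1/(4KA³)`, of width `δ < δ₁`
  obtain ⟨δ, hδ, hδlt, hδthin⟩ := hthin (1 / (4 * (K * A ^ 3))) (by positivity) δ₁ hδ₁
  have hδ3 : 0 < δ / 3 := by positivity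
  have hδ3le : δ / 3 ≤ δ₁ := by linarith
  have hδ316 : δ / 3 ≤ 16⁻¹ := hδ3le.trans hδ₁le
  -- the tube current of width `δ/3` and the smooth tube law for it
  obtain ⟨ρ, ηp, hρs, hηs, hρp, hηp, hηb, hρb, hρ'b, hηsupp, hρ'supp, hws, hwd, hwz, hfw⟩ :=
    hprof (δ / 3) hδ3 hδ3le
  have hsm := htube A (δ / 3) ρ ηp hA hδ3 hδ316 hρs hηs hρp hηp hηb hρb hρ'b hηsupp hρ'supp
  -- `v ∈ V` lies in the mirror class and has finite enstrophy
  have hvK : v ∈ mirrorClass := hK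
  have hG : Torus.eGradNormSq ((v : Lp (EuclideanSpace ℝ (Fin 3)) 2 (volume : Measure (UnitAddTorus (Fin 3)))) :
      UnitAddTorus (Fin 3) → EuclideanSpace ℝ (Fin 3)) ≠ ⊤ :=
    (Torus.MemSobolev.eGradNormSq_lt_top hV.2).ne
  -- uniqueness of weak derivatives: the thin gradient `g` majorises the local enstrophy of every weak gradient
  have hΛ : ∀ w : Fin 3 → UnitAddTorus (Fin 3) → EuclideanSpace ℝ (Fin 3),
      (∀ j, Torus.HasWeakPartialDeriv j
        ((v : Lp (EuclideanSpace ℝ (Fin 3)) 2 (volume : Measure (UnitAddTorus (Fin 3)))) :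
          UnitAddTorus (Fin 3) → EuclideanSpace ℝ (Fin 3)) (w j)) →
      (∀ j, MemLp (w j) 2 volume) →
      ∫⁻ x in {x : UnitAddTorus (Fin 3) | ‖x 2‖ ≤ δ / 3 ∧ (‖x 0‖ ≤ 2 * (δ / 3) ∨
          ‖x 0 - ((2⁻¹ : ℝ) : UnitAddCircle)‖ ≤ 2 * (δ / 3) ∨ ‖x 1‖ ≤ 2 * (δ / 3) ∨
          ‖x 1 - ((2⁻¹ : ℝ) : UnitAddCircle)‖ ≤ 2 * (δ / 3))}, ∑ j, ‖w j x‖ₑ ^ 2 ≤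
      ∫⁻ x in {x : UnitAddTorus (Fin 3) | ‖x 2‖ ≤ δ / 3 ∧ (‖x 0‖ ≤ 2 * (δ / 3) ∨
          ‖x 0 - ((2⁻¹ : ℝ) : UnitAddCircle)‖ ≤ 2 * (δ / 3) ∨ ‖x 1‖ ≤ 2 * (δ / 3) ∨
          ‖x 1 - ((2⁻¹ : ℝ) : UnitAddCircle)‖ ≤ 2 * (δ / 3))}, ∑ j, ‖g j x‖ₑ ^ 2 := by
    intro w hw hw2
    have hae : ∀ j, w j =ᵐ[volume] g j := fun j =>
      Torus.HasWeakPartialDeriv.unique_holds (d := Fin 3) (EuclideanSpace ℝ (Fin 3))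
        ((hw2 j).integrable one_le_two) ((hg j).1.integrable one_le_two) (hw j) (hg j).2
    refine (lintegral_congr_ae (ae_restrict_of_ae ?_)).le
    filter_upwards [ae_all_iff.2 hae] with x hx
    exact Finset.sum_congr rfl fun j _ => by rw [hx j]
  -- T3: the tube law transferred to `v`, with the thin gradient as majorant
  have key := stub_tubeLawTransferK (K * A ^ 3) (δ / 3) _ hKA.le hδ3 hws hsm v hvK hG _ hΛ
  -- `N_{δ/3} ⊆ T_δ`
  have e12 : (1 / 2 : ℝ) = 2⁻¹ := one_div 2
  have hsub : {x : UnitAddTorus (Fin 3) | ‖x 2‖ ≤ δ / 3 ∧ (‖x 0‖ ≤ 2 * (δ / 3) ∨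
      ‖x 0 - ((2⁻¹ : ℝ) : UnitAddCircle)‖ ≤ 2 * (δ / 3) ∨ ‖x 1‖ ≤ 2 * (δ / 3) ∨
      ‖x 1 - ((2⁻¹ : ℝ) : UnitAddCircle)‖ ≤ 2 * (δ / 3))} ⊆
      {x : UnitAddTorus (Fin 3) | (‖x 1‖ < δ ∨ ‖x 1 - ((1 / 2 : ℝ) : UnitAddCircle)‖ < δ ∨ ‖x 0‖ < δ ∨
        ‖x 0 - ((1 / 2 : ℝ) : UnitAddCircle)‖ < δ) ∧ ‖x 2‖ < δ} := by
    intro x hx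
    rw [Set.mem_setOf_eq] at hx ⊢
    rw [e12]
    obtain ⟨h2, h01⟩ := hx
    have hlt1 : δ / 3 < δ := by linarith
    have hlt2 : 2 * (δ / 3) < δ := by linarith
    refine ⟨?_, h2.trans_lt hlt1⟩
    rcases h01 with h | h | h | h
    · exact Or.inr (Or.inr (Or.inl (h.trans_lt hlt2)))
    · exact Or.inr (Or.inr (Or.inr (h.trans_lt hlt2)))
    · exact Or.inl (h.trans_lt hlt2)
    · exact Or.inr (Or.inl (h.trans_lt hlt2))
  have hloc := (lintegral_mono_set (μ := (volume : Measure (UnitAddTorus (Fin 3))))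
    (f := fun x => ∑ j : Fin 3, ‖g j x‖ₑ ^ 2) hsub).trans hδthin
  -- `|∫ (v ⊗ v) : ∇w| ≤ 3/4`
  have hconst : K * A ^ 3 / (δ / 3) * (1 / (4 * (K * A ^ 3)) * δ) = 3 / 4 := by
    field_simp
  have hIP := (key.trans (mul_le_mul' le_rfl hloc)).trans_eq
    (by rw [← ENNReal.ofReal_mul (by positivity), hconst])
  have hab := abs_le.1 ((ENNReal.ofReal_le_ofReal_iff (by norm_num)).1 hIP)
  -- the steady weak Euler equation tested with `w`
  have hw0 := hsol _ hws hwd hwz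
  unfold Torus.nsGeneratorPairing at hw0
  have hfT : f = tgForce := hf
  rw [zero_mul, add_zero, hfT] at hw0
  linarith [hab.1, hab.2, hfw, hw0]

end Summit.AnomalousDissipation.AnomalousDissipation.Theorems.SteadyMirrorGateNoThinMirrorRootTG

end
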